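import Literature.NumberTheory.LFunctions.Zhang2022.Section9GatheringInputs
import HarnessLib

/-!
# Zhang (2022) §9 p. 51: the core estimate of the gathering (G9) behind `Z22:§9.u004`, relative form

Y. Zhang, *Discrete mean estimates and the Landau–Siegel zero*, arXiv:2211.02515v1 (2022)
[Zhang2022LandauSiegel] — **an unrefereed manuscript under adjudication; nothing here asserts anything
about its Theorems 1–2 or about Landau–Siegel zeros.** ZHANG-L discharge lane (WP09), leaf
`Section9Statements.Step9u004r c′` (hypothesis `h9u004r` of `Skeleton.theorem1_of_leaves_v19`).

The §9 twin of `Section8FrontEnd44ReductionRel.coreRel` ("in a way similar to the proof of (8.12)",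
tex L2613). By `Section9FrontEndExact.Sj_a12_a22_eq`,
`S_j(𝐚₁₂,𝐚₂₂) = Σ_{n<P₃}Σ_{dr=n} w(ῑ₃M₃+ῑ₄M₂)(ι₃N₃+ι₄N₂) + Σ_{P₃≤n<P₂}Σ_{dr=n} w(ῑ₄M₂)(ι₄N₂)`; writing
`(ῑ₃M₃+ῑ₄M₂)(ι₃N₃+ι₄N₂) = ῑ₄ι₄·(M₂+κM₃)(N₂+κ̄N₃)` with `κ = ῑ₃/ῑ₄` (`|κ| ≤ 2`, `|ι₄|² ≤ 4`) puts both
ranges in the shape of the §8 bookkeeping lemmas `pointwise_I_rel … pointwise_IV_rel` with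
`(P₁,P₂;ϰ₁,ϰ₂;ι₂) ↦ (P₂,P₃;ϰ₂,ϰ₃;κ)`. The four ranges of `n = dr` are `n < P₃/T` (all four inner sums
approximated, Lemmas 8.2/8.4), `P₃/T ≤ n < P₃` (`M₃, N₃` trivially bounded via `xiZeroTailMean`),
`P₃ ≤ n < P₂/T`, `P₂/T ≤ n < P₂`; the `N`-errors carry the relative factor `(∏_{q∣dr}(1−q⁻¹)⁻¹)²` of
`Skeleton.Lemma84Rel`, absorbed by `range_sum_le_rel`. Total `≤ K(log T)⁷𝓛⁻¹⁷ = o(α)`.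

Theorem-only; 0 definitions, 0 new facts. WHAT THIS IS NOT: a proof of Lemmas 8.2/8.4 or of
Proposition 7.1.

## References

* Y. Zhang, arXiv:2211.02515v1 (2022), §9 p. 51, tex L2598–L2618; §8 p. 47, tex L2420–L2442;
  (8.6), (2.21), (2.26). [cite: Zhang2022LandauSiegel, §9 p.51]
-/

noncomputable section

open Complex Real ComplexConjugate Finset

namespace Literature.NumberTheory.LFunctions.Zhang2022.Section9Gathering

open Literature.NumberTheory.LFunctions.Zhang2022.Skeleton
open Literature.NumberTheory.LFunctions.Zhang2022.Section8FrontEnd82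
open Literature.NumberTheory.LFunctions.Zhang2022.Section8FrontEnd44Sizes
open Literature.NumberTheory.LFunctions.Zhang2022.Section8FrontEnd44Reduction
open Literature.NumberTheory.LFunctions.Zhang2022.Section8FrontEnd44ReductionRel

/-! ## The constants `ι₃, ι₄` of (2.26) -/

/-- `|ι₄| ≤ 2` for `ι₄ = −0.68738 + 1.60688i` of (2.26). [cite: Zhang2022LandauSiegel, §2 (2.26) p.10] -/
theorem norm_iota4_le_two : ‖iota4‖ ≤ 2 := by
  have h : ‖iota4‖ ^ 2 ≤ 2 ^ 2 := by
    rw [Complex.sq_norm, iota4]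
    simp [Complex.normSq_apply]
    norm_num
  exact le_of_pow_le_pow_left₀ two_ne_zero (by norm_num) h

/-- `|ι₃| ≤ 1.1` for `ι₃ = −1.00635 − 0.22789i` of (2.26). [cite: Zhang2022LandauSiegel, §2 (2.26) p.10] -/
theorem norm_iota3_le : ‖iota3‖ ≤ 1.1 := by
  have h : ‖iota3‖ ^ 2 ≤ (1.1 : ℝ) ^ 2 := by
    rw [Complex.sq_norm, iota3]
    simp [Complex.normSq_apply]
    norm_num
  exact le_of_pow_le_pow_left₀ two_ne_zero (by norm_num) h

/-- `1.6 ≤ |ι₄|` (`Im ι₄ = 1.60688`). [cite: Zhang2022LandauSiegel, §2 (2.26) p.10] -/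
theorem norm_iota4_ge : 1.6 ≤ ‖iota4‖ := by
  have h := Complex.abs_im_le_norm iota4
  have him : iota4.im = 1.60688 := by simp [iota4]
  rw [him] at h
  have : (1.6 : ℝ) ≤ |(1.60688 : ℝ)| := by norm_num
  linarith

/-- `ι₄ ≠ 0`. [cite: Zhang2022LandauSiegel, §2 (2.26) p.10] -/
theorem iota4_ne_zero : iota4 ≠ 0 := by
  intro h
  have := norm_iota4_ge
  rw [h, norm_zero] at this
  linarith

/-- The ratio `κ = ῑ₃/ῑ₄` has `|κ| ≤ 2`, and `ῑ₄κ = ῑ₃`, `ι₄κ̄ = ι₃`, `|ῑ₄ι₄| ≤ 4`: the algebra that puts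
the §9 products `(ῑ₃M₃+ῑ₄M₂)(ι₃N₃+ι₄N₂)` into the §8 shape `ῑ₄ι₄·(M₂+κM₃)(N₂+κ̄N₃)`.
[cite: Zhang2022LandauSiegel, §9 p.51, tex L2598–L2601; (2.26)] -/
theorem kappa_facts :
    ‖conj iota3 / conj iota4‖ ≤ 2 ∧ conj iota4 * (conj iota3 / conj iota4) = conj iota3 ∧
      iota4 * conj (conj iota3 / conj iota4) = iota3 ∧ ‖conj iota4 * iota4‖ ≤ 4 ∧
      ∀ M₃ M₂ N₃ N₂ : ℂ, (conj iota3 * M₃ + conj iota4 * M₂) * (iota3 * N₃ + iota4 * N₂) =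
        conj iota4 * iota4 * ((M₂ + conj iota3 / conj iota4 * M₃) *
          (N₂ + conj (conj iota3 / conj iota4) * N₃)) := by
  have h4 : iota4 ≠ 0 := iota4_ne_zero
  have hc4 : conj iota4 ≠ 0 := (map_ne_zero_iff _ (RingHom.injective _)).mpr h4
  have e1 : conj iota4 * (conj iota3 / conj iota4) = conj iota3 := by field_simp
  have e2 : iota4 * conj (conj iota3 / conj iota4) = iota3 := by
    rw [map_div₀, Complex.conj_conj, Complex.conj_conj]; field_simp
  refine ⟨?_, e1, e2, ?_, ?_⟩
  · rw [norm_div, Complex.norm_conj, Complex.norm_conj, div_le_iff₀ (by linarith [norm_iota4_ge])]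
    linarith [norm_iota3_le, norm_iota4_ge]
  · rw [norm_mul, Complex.norm_conj]
    nlinarith [norm_iota4_le_two, norm_nonneg iota4]
  · intro M₃ M₂ N₃ N₂
    set κ : ℂ := conj iota3 / conj iota4 with hκ
    rw [← e1, ← e2]
    ring

/-! ## The reduction, relative form, for fixed `D`, `χ`, `j` -/

set_option maxHeartbeats 400000 in
/-- **Core estimate of the §9 gathering (G9), RELATIVE form** (the §9 twin of
`Section8FrontEnd44ReductionRel.coreRel`). For constants `C₁, C₂ ≥ 0` there is `K = K(c′, C₁, C₂)` such
that: for every `D ≥ ⌈e⁴⌉`, real primitive `χ (mod D)` and `j`, if the four applications of Lemmas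
8.2/8.4 (`Z22:§8.u041`, `§9.u002` with error `C₁𝓛⁻¹⁵` on `dr < P_k/T`; `Z22:§8.u043`, `§9.u003` with
error `C₁𝓛⁻¹⁵·(∏_{q∣dr}(1−q⁻¹)⁻¹)²`) hold at this `D, χ, j` and the tail mean
`Σ_{n<x}|ξ₀ⱼ(n;d,r)|/n ≤ C₂𝓛(1 + log x)³` (`x ≤ T`, `dr < P₁`) holds, then `S_j(𝐚₁₂,𝐚₂₂)` differs from
the gathered two-range form (main terms inserted, weights `w_j(d,r)Π(d,r)`) by at most `K(log T)⁷𝓛⁻¹⁷`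
(`= K𝓛^{-9.3} = o(α)`). [cite: Zhang2022LandauSiegel, §9 p.51, tex L2613; §8 p.47, tex L2436] -/
theorem core9Rel (c' : ℝ) {C₁ C₂ : ℝ} (hC₁ : 0 ≤ C₁) (hC₂ : 0 ≤ C₂) :
    ∃ K : ℝ, 0 ≤ K ∧ ∀ {D : ℕ} [NeZero D] {χ : DirichletCharacter ℂ D}, χ.IsQuadratic →
      χ.IsPrimitive → ⌈Real.exp 4⌉₊ ≤ D → ∀ j : ℕ,
      (∀ d r : ℕ, 1 ≤ d → 1 ≤ r → ((d * r : ℕ) : ℝ) < Skeleton.P2 D / bigT D →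
        ‖(∑ m ∈ Finset.Ico 1 (Nsupp D),
              χ (m : ZMod D) * vk2 D (d * r * m) / (m : ℂ) ^ (1 - betaJ c' D j)) -
            deriv χ.LFunction 1 / (Real.log (Skeleton.P2 D) : ℂ) *
              frakfW c' D j 7 (Skeleton.P2 D / ((d * r : ℕ) : ℝ))‖ ≤ C₁ / ell D ^ 15) →
      (∀ d r : ℕ, 1 ≤ d → 1 ≤ r → ((d * r : ℕ) : ℝ) < Skeleton.P3 D / bigT D →
        ‖(∑ m ∈ Finset.Ico 1 (Nsupp D),
              χ (m : ZMod D) * vk3 D (d * r * m) / (m : ℂ) ^ (1 - betaJ c' D j)) -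
            deriv χ.LFunction 1 / (Real.log (Skeleton.P3 D) : ℂ) *
              frakfW c' D j 6 (Skeleton.P3 D / ((d * r : ℕ) : ℝ))‖ ≤ C₁ / ell D ^ 15) →
      (∀ d r : ℕ, 1 ≤ d → 1 ≤ r → ((d * r : ℕ) : ℝ) < Skeleton.P2 D / bigT D →
        ‖(∑ n ∈ Finset.Ico 1 (Nsupp D),
              χ (n : ZMod D) * conj (vk2 D (d * r * n)) * xiZero c' D j n d r / (n : ℂ)) -
            deriv χ.LFunction 1 * PiW χ d r / (Real.log (Skeleton.P2 D) : ℂ) *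
              frakgW c' D j 7 (Skeleton.P2 D / ((d * r : ℕ) : ℝ))‖ ≤
          C₁ / ell D ^ 15 * (∏ q ∈ (d * r).primeFactors, (1 - (q : ℝ)⁻¹)⁻¹) ^ 2) →
      (∀ d r : ℕ, 1 ≤ d → 1 ≤ r → ((d * r : ℕ) : ℝ) < Skeleton.P3 D / bigT D →
        ‖(∑ n ∈ Finset.Ico 1 (Nsupp D),
              χ (n : ZMod D) * conj (vk3 D (d * r * n)) * xiZero c' D j n d r / (n : ℂ)) -
            deriv χ.LFunction 1 * PiW χ d r / (Real.log (Skeleton.P3 D) : ℂ) *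
              frakgW c' D j 6 (Skeleton.P3 D / ((d * r : ℕ) : ℝ))‖ ≤
          C₁ / ell D ^ 15 * (∏ q ∈ (d * r).primeFactors, (1 - (q : ℝ)⁻¹)⁻¹) ^ 2) →
      (∀ d r : ℕ, 1 ≤ d → 1 ≤ r → ((d * r : ℕ) : ℝ) < Skeleton.P1 D → ∀ x : ℝ, 1 ≤ x →
        x ≤ bigT D → ∑ n ∈ Finset.Ico 1 ⌈x⌉₊, ‖xiZero c' D j n d r‖ / n ≤
          C₂ * ell D * (1 + Real.log x) ^ 3) →
      ‖Sj c' D j (a12 χ) (a22 χ) -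
          (deriv χ.LFunction 1 ^ 2 *
              (∑ n ∈ Finset.Ico 1 ⌈Skeleton.P3 D⌉₊, ∑ p ∈ Nat.divisorsAntidiagonal n,
                ((ArithmeticFunction.moebius p.2).natAbs : ℂ) *
                      (‖χ ((p.1 * p.2 : ℕ) : ZMod D)‖ : ℂ) /
                    (((p.1 * p.2 : ℕ) : ℂ) * (Nat.totient p.2 : ℂ)) *
                  lamZero c' D j (p.1 * p.2) * PiW χ p.1 p.2 *
                  ((conj iota3 * frakfW c' D j 6 (Skeleton.P3 D / n) / (Real.log (Skeleton.P3 D) : ℂ) +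
                      conj iota4 * frakfW c' D j 7 (Skeleton.P2 D / n) /
                        (Real.log (Skeleton.P2 D) : ℂ)) *
                    (iota3 * frakgW c' D j 6 (Skeleton.P3 D / n) / (Real.log (Skeleton.P3 D) : ℂ) +
                      iota4 * frakgW c' D j 7 (Skeleton.P2 D / n) /
                        (Real.log (Skeleton.P2 D) : ℂ)))) +
            deriv χ.LFunction 1 ^ 2 *
              (∑ n ∈ Finset.Ico ⌈Skeleton.P3 D⌉₊ ⌈Skeleton.P2 D⌉₊, ∑ p ∈ Nat.divisorsAntidiagonal n,
                ((ArithmeticFunction.moebius p.2).natAbs : ℂ) *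
                      (‖χ ((p.1 * p.2 : ℕ) : ZMod D)‖ : ℂ) /
                    (((p.1 * p.2 : ℕ) : ℂ) * (Nat.totient p.2 : ℂ)) *
                  lamZero c' D j (p.1 * p.2) * PiW χ p.1 p.2 *
                  (conj iota4 * frakfW c' D j 7 (Skeleton.P2 D / n) / (Real.log (Skeleton.P2 D) : ℂ) *
                    (iota4 * frakgW c' D j 7 (Skeleton.P2 D / n) /
                      (Real.log (Skeleton.P2 D) : ℂ)))))‖ ≤
        K * (ell D ^ (1.1 : ℝ)) ^ 7 / ell D ^ 17 := by
  obtain ⟨F₀, hF₀⟩ : ∃ F₀ : ℝ, F₀ = 1 + (5.5 + 60 * |c'|) * π := ⟨_, rfl⟩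
  obtain ⟨G₀, hG₀⟩ : ∃ G₀ : ℝ, G₀ = 1 + 8 * (1 + 20 * |c'|) ^ 2 + (5.5 + 60 * |c'|) ^ 2 * π :=
    ⟨_, rfl⟩
  have hF₀0 : 0 ≤ F₀ := by rw [hF₀]; positivity
  have hG₀0 : 0 ≤ G₀ := by rw [hG₀]; positivity
  obtain ⟨S, hS⟩ : ∃ S : ℝ, S = 16 * Real.exp (9 / 2) * (F₀ + G₀) + C₁ + 1 := ⟨_, rfl⟩
  have hS0 : 0 ≤ S := by rw [hS]; positivity
  have hC₁S : C₁ ≤ S := by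
    rw [hS]; have : 0 ≤ 16 * Real.exp (9 / 2) * (F₀ + G₀) := by positivity
    linarith
  refine ⟨4 * (Real.exp 430 * (80 * C₁ * S + 112 * S ^ 2 + 1536 * S * C₂ + 384 * S + 5120 * C₂)),
    by positivity, ?_⟩
  intro D _ χ hq hχ hD4 j h41 h92 h43 h93 hξ
  -- the constants `ι₃, ι₄`
  obtain ⟨hκ, hκ1, hκ2, hc44, halg⟩ := kappa_facts
  set κ : ℂ := conj iota3 / conj iota4 with hκdef
  -- parameters
  have hL4 : 4 ≤ ell D := four_le_ell hD4
  have hD3c : ⌈Real.exp 3⌉₊ ≤ D :=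
    le_trans (Nat.ceil_mono (Real.exp_le_exp.mpr (by norm_num))) hD4
  have hL3 : 3 ≤ ell D := three_le_ell hD3c
  have hD3' : 3 ≤ D := three_le_of_ceil hD3c
  have hL2 : 2 ≤ ell D := by linarith
  have hL1 : 1 ≤ ell D := by linarith
  have hL0 : 0 < ell D := by linarith
  obtain ⟨-, hlogP2, -, hP2PT, -, -, -, hP2P⟩ := params hL2
  obtain ⟨hTP2, -, hlogT, hLτ, hT1⟩ := params2 hL2
  obtain ⟨hlogP3, hlogP3', hP3PT, hTP3, hP3TP2, hP3P⟩ := params3 hL4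
  have hL' : ‖deriv χ.LFunction 1‖ ≤ 4 * Real.exp (9 / 2) * ell D ^ 2 :=
    norm_deriv_LFunction_one_le χ hχ hL3
  set τ : ℝ := ell D ^ (1.1 : ℝ) with hτdef
  have hτ1 : 1 ≤ τ := hL1.trans hLτ
  have hτ0 : 0 < τ := by linarith
  have hT0 : 0 < bigT D := by linarith
  have hP3pos : 0 < Skeleton.P3 D := by linarith
  have hP3one : 1 < Skeleton.P3 D := lt_of_lt_of_le hT1 hTP3
  have hP2pos : 0 < Skeleton.P2 D := lt_of_lt_of_le (mul_pos hP3pos hT0) hP3TP2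
  have hP3P2T : Skeleton.P3 D ≤ Skeleton.P2 D / bigT D := (le_div_iff₀ hT0).mpr hP3TP2
  have hP2TP2 : Skeleton.P2 D / bigT D ≤ Skeleton.P2 D := div_le_self hP2pos.le hT1.le
  have hP3TP3 : Skeleton.P3 D / bigT D ≤ Skeleton.P3 D := div_le_self hP3pos.le hT1.le
  have hP3T1 : 1 ≤ Skeleton.P3 D / bigT D := (one_le_div hT0).mpr hTP3
  have hP3P2 : Skeleton.P3 D ≤ Skeleton.P2 D := hP3P2T.trans hP2TP2
  have hP2one : 1 < Skeleton.P2 D := lt_of_lt_of_le hP3one hP3P2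
  have hP3P1 : Skeleton.P3 D ≤ Skeleton.P1 D := P3_le_P1 D
  have hP2P1 : Skeleton.P2 D ≤ Skeleton.P1 D := P2_le_P1 D
  have hlogP3pos : 0 < Real.log (Skeleton.P3 D) := lt_of_lt_of_le (by positivity) hlogP3'
  have hlogP2pos : 0 < Real.log (Skeleton.P2 D) := lt_of_lt_of_le (by positivity) hlogP2
  have hlogP : Real.log (bigP D) = ell D ^ 9 := by rw [bigP, Real.log_exp]
  -- scales
  have hsc := scales (L := ell D) (τ := τ) (S := S) hL1 hLτ hS0 hC₁ hC₂
  set δ : ℝ := C₁ / ell D ^ 15 with hδ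
  set σ : ℝ := S / ell D ^ 7 with hσ
  set m : ℝ := 8 * τ ^ 2 / ell D ^ 9 with hm
  set ν : ℝ := 32 * C₂ * τ ^ 4 / ell D ^ 8 with hν
  rw [mul_div_assoc]
  set u : ℝ := τ ^ 7 / ell D ^ 17 with hu
  obtain ⟨s1, s2, s3, s4, s5⟩ := hsc
  have hδ0 : 0 ≤ δ := by rw [hδ]; positivity
  have hσ0 : 0 ≤ σ := by rw [hσ]; positivity
  have hm0 : 0 ≤ m := by rw [hm]; positivity
  have hν0 : 0 ≤ ν := by rw [hν]; positivity
  have hu0 : 0 ≤ u := by rw [hu]; positivity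
  have hδσ : δ ≤ σ := by
    rw [hδ, hσ]
    exact div_le_div₀ hS0 hC₁S (by positivity) (pow_le_pow_right₀ hL1 (by norm_num))
  have hδσ0 : 0 ≤ δ * σ := mul_nonneg hδ0 hσ0
  have hσν0 : 0 ≤ σ * ν := mul_nonneg hσ0 hν0
  have hmσ0 : 0 ≤ m * σ := mul_nonneg hm0 hσ0
  have hmν0 : 0 ≤ m * ν := mul_nonneg hm0 hν0
  have hσσ0 : 0 ≤ σ ^ 2 := sq_nonneg σ
  have hEI0 : 0 ≤ 18 * δ * σ := by linarith
  have hEII0 : 0 ≤ 27 * σ ^ 2 + 12 * σ * ν + 12 * m * σ + 4 * m * ν := by linarith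
  have hEIII0 : 0 ≤ 2 * δ * σ := by linarith
  have hEIV0 : 0 ≤ m * ν + σ ^ 2 := by linarith
  have he430 : 0 ≤ 2 * Real.exp 430 := by positivity
  have hσF : 4 * Real.exp (9 / 2) * ell D ^ 2 * F₀ / (ell D ^ 9 / 4) ≤ σ := by
    rw [hσ, div_le_div_iff₀ (by positivity) (by positivity)]
    have hrest : 0 ≤ (16 * Real.exp (9 / 2) * G₀ + C₁ + 1) * ell D ^ 9 := by positivity
    calc 4 * Real.exp (9 / 2) * ell D ^ 2 * F₀ * ell D ^ 7
        = (16 * Real.exp (9 / 2) * F₀) * ell D ^ 9 / 4 := by ring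
      _ ≤ ((16 * Real.exp (9 / 2) * F₀) * ell D ^ 9 +
            (16 * Real.exp (9 / 2) * G₀ + C₁ + 1) * ell D ^ 9) / 4 := by linarith
      _ = S * (ell D ^ 9 / 4) := by rw [hS]; ring
  have hσG : 4 * Real.exp (9 / 2) * ell D ^ 2 * G₀ / (ell D ^ 9 / 4) ≤ σ := by
    rw [hσ, div_le_div_iff₀ (by positivity) (by positivity)]
    have hrest : 0 ≤ (16 * Real.exp (9 / 2) * F₀ + C₁ + 1) * ell D ^ 9 := by positivity
    calc 4 * Real.exp (9 / 2) * ell D ^ 2 * G₀ * ell D ^ 7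
        = (16 * Real.exp (9 / 2) * G₀) * ell D ^ 9 / 4 := by ring
      _ ≤ ((16 * Real.exp (9 / 2) * G₀) * ell D ^ 9 +
            (16 * Real.exp (9 / 2) * F₀ + C₁ + 1) * ell D ^ 9) / 4 := by linarith
      _ = S * (ell D ^ 9 / 4) := by rw [hS]; ring
  -- the main-term sizes, abstractly
  have hAk : ∀ {Q y : ℝ} (μ : ℕ), ell D ^ 9 / 4 ≤ Real.log Q → 1 ≤ y → y ≤ bigP D →
      ‖deriv χ.LFunction 1 / (Real.log Q : ℂ) * frakfW c' D j μ y‖ ≤ σ := by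
    intro Q y μ hℓQ hy1 hyP
    have hlogQ : 0 < Real.log Q := lt_of_lt_of_le (by positivity) hℓQ
    have hf : ‖frakfW c' D j μ y‖ ≤ F₀ := by rw [hF₀]; exact norm_frakfW_le c' hD3' j μ hy1 hyP
    rw [norm_mul, norm_div, Complex.norm_real, Real.norm_of_nonneg hlogQ.le]
    calc ‖deriv χ.LFunction 1‖ / Real.log Q * ‖frakfW c' D j μ y‖
        ≤ 4 * Real.exp (9 / 2) * ell D ^ 2 / (ell D ^ 9 / 4) * F₀ :=
          mul_le_mul (div_le_div₀ (by positivity) hL' (by positivity) hℓQ) hf (norm_nonneg _)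
            (by positivity)
      _ = 4 * Real.exp (9 / 2) * ell D ^ 2 * F₀ / (ell D ^ 9 / 4) := by ring
      _ ≤ σ := hσF
  have hBk : ∀ {Q y : ℝ} (μ d r : ℕ), ell D ^ 9 / 4 ≤ Real.log Q → 1 ≤ y → y ≤ bigP D →
      ‖deriv χ.LFunction 1 * PiW χ d r / (Real.log Q : ℂ) * frakgW c' D j μ y‖ ≤
        σ * ‖PiW χ d r‖ := by
    intro Q y μ d r hℓQ hy1 hyP
    have hlogQ : 0 < Real.log Q := lt_of_lt_of_le (by positivity) hℓQ
    have hg : ‖frakgW c' D j μ y‖ ≤ G₀ := by rw [hG₀]; exact norm_frakgW_le c' hD3' j μ hy1 hyP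
    rw [norm_mul, norm_div, norm_mul, Complex.norm_real, Real.norm_of_nonneg hlogQ.le]
    calc ‖deriv χ.LFunction 1‖ * ‖PiW χ d r‖ / Real.log Q * ‖frakgW c' D j μ y‖
        = ‖deriv χ.LFunction 1‖ / Real.log Q * ‖frakgW c' D j μ y‖ * ‖PiW χ d r‖ := by ring
      _ ≤ 4 * Real.exp (9 / 2) * ell D ^ 2 / (ell D ^ 9 / 4) * G₀ * ‖PiW χ d r‖ :=
          mul_le_mul_of_nonneg_right
            (mul_le_mul (div_le_div₀ (by positivity) hL' (by positivity) hℓQ) hg (norm_nonneg _)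
              (by positivity)) (norm_nonneg _)
      _ = 4 * Real.exp (9 / 2) * ell D ^ 2 * G₀ / (ell D ^ 9 / 4) * ‖PiW χ d r‖ := by ring
      _ ≤ σ * ‖PiW χ d r‖ := mul_le_mul_of_nonneg_right hσG (norm_nonneg _)
  -- the objects
  set M₂ : ℕ × ℕ → ℂ := fun p => ∑ m ∈ Finset.Ico 1 (Nsupp D),
    χ (m : ZMod D) * vk2 D (p.1 * p.2 * m) / (m : ℂ) ^ (1 - betaJ c' D j) with hM₂
  set M₃ : ℕ × ℕ → ℂ := fun p => ∑ m ∈ Finset.Ico 1 (Nsupp D),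
    χ (m : ZMod D) * vk3 D (p.1 * p.2 * m) / (m : ℂ) ^ (1 - betaJ c' D j) with hM₃
  set N₂ : ℕ × ℕ → ℂ := fun p => ∑ n ∈ Finset.Ico 1 (Nsupp D),
    χ (n : ZMod D) * conj (vk2 D (p.1 * p.2 * n)) * xiZero c' D j n p.1 p.2 / (n : ℂ) with hN₂
  set N₃ : ℕ × ℕ → ℂ := fun p => ∑ n ∈ Finset.Ico 1 (Nsupp D),
    χ (n : ZMod D) * conj (vk3 D (p.1 * p.2 * n)) * xiZero c' D j n p.1 p.2 / (n : ℂ) with hN₃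
  set A₂ : ℕ × ℕ → ℂ := fun p => deriv χ.LFunction 1 / (Real.log (Skeleton.P2 D) : ℂ) *
    frakfW c' D j 7 (Skeleton.P2 D / ((p.1 * p.2 : ℕ) : ℝ)) with hA₂
  set A₃ : ℕ × ℕ → ℂ := fun p => deriv χ.LFunction 1 / (Real.log (Skeleton.P3 D) : ℂ) *
    frakfW c' D j 6 (Skeleton.P3 D / ((p.1 * p.2 : ℕ) : ℝ)) with hA₃
  set B₂ : ℕ × ℕ → ℂ := fun p => deriv χ.LFunction 1 * PiW χ p.1 p.2 /
    (Real.log (Skeleton.P2 D) : ℂ) * frakgW c' D j 7 (Skeleton.P2 D / ((p.1 * p.2 : ℕ) : ℝ)) with hB₂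
  set B₃ : ℕ × ℕ → ℂ := fun p => deriv χ.LFunction 1 * PiW χ p.1 p.2 /
    (Real.log (Skeleton.P3 D) : ℂ) * frakgW c' D j 6 (Skeleton.P3 D / ((p.1 * p.2 : ℕ) : ℝ)) with hB₃
  set w : ℕ × ℕ → ℂ := fun p => ((ArithmeticFunction.moebius p.2).natAbs : ℂ) *
    (‖χ ((p.1 * p.2 : ℕ) : ZMod D)‖ : ℂ) / (((p.1 * p.2 : ℕ) : ℂ) * (Nat.totient p.2 : ℂ)) *
    lamZero c' D j (p.1 * p.2) with hw
  -- Step 1: the exact form of `S_j`, in the §8 shape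
  have hSj : Sj c' D j (a12 χ) (a22 χ) =
      conj iota4 * iota4 *
          (∑ n ∈ Finset.Ico 1 ⌈Skeleton.P3 D⌉₊, ∑ p ∈ Nat.divisorsAntidiagonal n,
            w p * ((M₂ p + κ * M₃ p) * (N₂ p + conj κ * N₃ p))) +
        conj iota4 * iota4 *
          ∑ n ∈ Finset.Ico ⌈Skeleton.P3 D⌉₊ ⌈Skeleton.P2 D⌉₊, ∑ p ∈ Nat.divisorsAntidiagonal n,
            w p * (M₂ p * N₂ p) := by
    rw [Section9FrontEndExact.Sj_a12_a22_eq c' hq hP2PT hP3P2 j]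
    congr 1
    · rw [Finset.mul_sum]
      refine Finset.sum_congr rfl fun n _ => ?_
      rw [Finset.mul_sum]
      refine Finset.sum_congr rfl fun p _ => ?_
      simp only [hw, hM₂, hM₃, hN₂, hN₃]
      rw [halg]
      ring
    · rw [Finset.mul_sum]
      refine Finset.sum_congr rfl fun n _ => ?_
      rw [Finset.mul_sum]
      refine Finset.sum_congr rfl fun p _ => ?_
      simp only [hw, hM₂, hN₂]
      ring
  -- Step 2: the gathered form in the same shape
  have hTgt : deriv χ.LFunction 1 ^ 2 *
        (∑ n ∈ Finset.Ico 1 ⌈Skeleton.P3 D⌉₊, ∑ p ∈ Nat.divisorsAntidiagonal n,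
          ((ArithmeticFunction.moebius p.2).natAbs : ℂ) *
                (‖χ ((p.1 * p.2 : ℕ) : ZMod D)‖ : ℂ) /
              (((p.1 * p.2 : ℕ) : ℂ) * (Nat.totient p.2 : ℂ)) *
            lamZero c' D j (p.1 * p.2) * PiW χ p.1 p.2 *
            ((conj iota3 * frakfW c' D j 6 (Skeleton.P3 D / n) / (Real.log (Skeleton.P3 D) : ℂ) +
                conj iota4 * frakfW c' D j 7 (Skeleton.P2 D / n) /
                  (Real.log (Skeleton.P2 D) : ℂ)) *
              (iota3 * frakgW c' D j 6 (Skeleton.P3 D / n) / (Real.log (Skeleton.P3 D) : ℂ) +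
                iota4 * frakgW c' D j 7 (Skeleton.P2 D / n) /
                  (Real.log (Skeleton.P2 D) : ℂ)))) +
      deriv χ.LFunction 1 ^ 2 *
        (∑ n ∈ Finset.Ico ⌈Skeleton.P3 D⌉₊ ⌈Skeleton.P2 D⌉₊, ∑ p ∈ Nat.divisorsAntidiagonal n,
          ((ArithmeticFunction.moebius p.2).natAbs : ℂ) *
                (‖χ ((p.1 * p.2 : ℕ) : ZMod D)‖ : ℂ) /
              (((p.1 * p.2 : ℕ) : ℂ) * (Nat.totient p.2 : ℂ)) *
            lamZero c' D j (p.1 * p.2) * PiW χ p.1 p.2 *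
            (conj iota4 * frakfW c' D j 7 (Skeleton.P2 D / n) / (Real.log (Skeleton.P2 D) : ℂ) *
              (iota4 * frakgW c' D j 7 (Skeleton.P2 D / n) /
                (Real.log (Skeleton.P2 D) : ℂ)))) =
      conj iota4 * iota4 *
          (∑ n ∈ Finset.Ico 1 ⌈Skeleton.P3 D⌉₊, ∑ p ∈ Nat.divisorsAntidiagonal n,
            w p * ((A₂ p + κ * A₃ p) * (B₂ p + conj κ * B₃ p))) +
        conj iota4 * iota4 *
          ∑ n ∈ Finset.Ico ⌈Skeleton.P3 D⌉₊ ⌈Skeleton.P2 D⌉₊, ∑ p ∈ Nat.divisorsAntidiagonal n,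
            w p * (A₂ p * B₂ p) := by
    congr 1
    · rw [Finset.mul_sum, Finset.mul_sum]
      refine Finset.sum_congr rfl fun n _ => ?_
      rw [Finset.mul_sum, Finset.mul_sum]
      refine Finset.sum_congr rfl fun p hp => ?_
      obtain ⟨hpn, -⟩ := Nat.mem_divisorsAntidiagonal.mp hp
      simp only [hw, hA₂, hA₃, hB₂, hB₃]
      rw [← hpn, ← hκ1, ← hκ2]
      ring
    · rw [Finset.mul_sum, Finset.mul_sum]
      refine Finset.sum_congr rfl fun n _ => ?_
      rw [Finset.mul_sum, Finset.mul_sum]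
      refine Finset.sum_congr rfl fun p hp => ?_
      obtain ⟨hpn, -⟩ := Nat.mem_divisorsAntidiagonal.mp hp
      simp only [hw, hA₂, hB₂]
      rw [← hpn]
      ring
  -- Step 3: pointwise inputs on the factorisations `n = dr`
  have hfacts : ∀ {n : ℕ} {p : ℕ × ℕ}, p ∈ Nat.divisorsAntidiagonal n →
      p.1 * p.2 = n ∧ 1 ≤ p.1 ∧ 1 ≤ p.2 ∧ 1 ≤ n := by
    intro n p hp
    obtain ⟨hpn, hn0⟩ := Nat.mem_divisorsAntidiagonal.mp hp
    refine ⟨hpn, Nat.one_le_iff_ne_zero.mpr fun h => hn0 (by rw [← hpn, h, zero_mul]),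
      Nat.one_le_iff_ne_zero.mpr fun h => hn0 (by rw [← hpn, h, mul_zero]),
      Nat.one_le_iff_ne_zero.mpr hn0⟩
  have hA₂p : ∀ {n : ℕ} {p : ℕ × ℕ}, p ∈ Nat.divisorsAntidiagonal n →
      (n : ℝ) < Skeleton.P2 D → ‖A₂ p‖ ≤ σ := by
    intro n p hp hn
    obtain ⟨hpn, -, -, hn1⟩ := hfacts hp
    have hn1R : (1 : ℝ) ≤ n := by exact_mod_cast hn1
    simp only [hA₂]
    rw [hpn]
    exact hAk 7 hlogP2 ((one_le_div (by linarith)).mpr hn.le)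
      ((div_le_self hP2pos.le hn1R).trans hP2P.le)
  have hA₃p : ∀ {n : ℕ} {p : ℕ × ℕ}, p ∈ Nat.divisorsAntidiagonal n →
      (n : ℝ) < Skeleton.P3 D → ‖A₃ p‖ ≤ σ := by
    intro n p hp hn
    obtain ⟨hpn, -, -, hn1⟩ := hfacts hp
    have hn1R : (1 : ℝ) ≤ n := by exact_mod_cast hn1
    simp only [hA₃]
    rw [hpn]
    exact hAk 6 hlogP3' ((one_le_div (by linarith)).mpr hn.le)
      ((div_le_self hP3pos.le hn1R).trans hP3P.le)
  have hB₂p : ∀ {n : ℕ} {p : ℕ × ℕ}, p ∈ Nat.divisorsAntidiagonal n →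
      (n : ℝ) < Skeleton.P2 D → ‖B₂ p‖ ≤ σ * ‖PiW χ p.1 p.2‖ := by
    intro n p hp hn
    obtain ⟨hpn, -, -, hn1⟩ := hfacts hp
    have hn1R : (1 : ℝ) ≤ n := by exact_mod_cast hn1
    simp only [hB₂]
    rw [hpn]
    exact hBk 7 p.1 p.2 hlogP2 ((one_le_div (by linarith)).mpr hn.le)
      ((div_le_self hP2pos.le hn1R).trans hP2P.le)
  have hB₃p : ∀ {n : ℕ} {p : ℕ × ℕ}, p ∈ Nat.divisorsAntidiagonal n →
      (n : ℝ) < Skeleton.P3 D → ‖B₃ p‖ ≤ σ * ‖PiW χ p.1 p.2‖ := by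
    intro n p hp hn
    obtain ⟨hpn, -, -, hn1⟩ := hfacts hp
    have hn1R : (1 : ℝ) ≤ n := by exact_mod_cast hn1
    simp only [hB₃]
    rw [hpn]
    exact hBk 6 p.1 p.2 hlogP3' ((one_le_div (by linarith)).mpr hn.le)
      ((div_le_self hP3pos.le hn1R).trans hP3P.le)
  have hMA₂ : ∀ {n : ℕ} {p : ℕ × ℕ}, p ∈ Nat.divisorsAntidiagonal n →
      (n : ℝ) < Skeleton.P2 D / bigT D → ‖M₂ p - A₂ p‖ ≤ δ := by
    intro n p hp hn
    obtain ⟨hpn, hp1, hp2, -⟩ := hfacts hp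
    have hlt : ((p.1 * p.2 : ℕ) : ℝ) < Skeleton.P2 D / bigT D := by rw [hpn]; exact hn
    simp only [hM₂, hA₂]
    exact h41 p.1 p.2 hp1 hp2 hlt
  have hMA₃ : ∀ {n : ℕ} {p : ℕ × ℕ}, p ∈ Nat.divisorsAntidiagonal n →
      (n : ℝ) < Skeleton.P3 D / bigT D → ‖M₃ p - A₃ p‖ ≤ δ := by
    intro n p hp hn
    obtain ⟨hpn, hp1, hp2, -⟩ := hfacts hp
    have hlt : ((p.1 * p.2 : ℕ) : ℝ) < Skeleton.P3 D / bigT D := by rw [hpn]; exact hn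
    simp only [hM₃, hA₃]
    exact h92 p.1 p.2 hp1 hp2 hlt
  have hNB₂ : ∀ {n : ℕ} {p : ℕ × ℕ}, p ∈ Nat.divisorsAntidiagonal n →
      (n : ℝ) < Skeleton.P2 D / bigT D →
        ‖N₂ p - B₂ p‖ ≤ δ * (∏ q ∈ n.primeFactors, (1 - (q : ℝ)⁻¹)⁻¹) ^ 2 := by
    intro n p hp hn
    obtain ⟨hpn, hp1, hp2, -⟩ := hfacts hp
    have hlt : ((p.1 * p.2 : ℕ) : ℝ) < Skeleton.P2 D / bigT D := by rw [hpn]; exact hn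
    simp only [hN₂, hB₂]
    exact (h43 p.1 p.2 hp1 hp2 hlt).trans_eq (by rw [hpn])
  have hNB₃ : ∀ {n : ℕ} {p : ℕ × ℕ}, p ∈ Nat.divisorsAntidiagonal n →
      (n : ℝ) < Skeleton.P3 D / bigT D →
        ‖N₃ p - B₃ p‖ ≤ δ * (∏ q ∈ n.primeFactors, (1 - (q : ℝ)⁻¹)⁻¹) ^ 2 := by
    intro n p hp hn
    obtain ⟨hpn, hp1, hp2, -⟩ := hfacts hp
    have hlt : ((p.1 * p.2 : ℕ) : ℝ) < Skeleton.P3 D / bigT D := by rw [hpn]; exact hn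
    simp only [hN₃, hB₃]
    exact (h93 p.1 p.2 hp1 hp2 hlt).trans_eq (by rw [hpn])
  -- the tail ranges: `x = P_k/n ∈ [1, T]`
  have htail : ∀ {Q : ℝ} {n : ℕ}, 0 < Q → Q / bigT D ≤ n → (n : ℝ) < Q →
      1 ≤ Q / n ∧ Q / n ≤ bigT D ∧ 0 ≤ Real.log (Q / n) ∧ Real.log (Q / n) ≤ τ := by
    intro Q n hQ hTn hn
    have hnR : (0 : ℝ) < n := lt_of_lt_of_le (div_pos hQ hT0) hTn
    have hx1 : 1 ≤ Q / n := (one_le_div hnR).mpr hn.le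
    have hxT : Q / n ≤ bigT D := by
      rw [div_le_iff₀ hnR]
      have := (div_le_iff₀ hT0).mp hTn
      linarith [mul_comm (n : ℝ) (bigT D)]
    refine ⟨hx1, hxT, Real.log_nonneg hx1, ?_⟩
    rw [← hlogT]
    exact Real.log_le_log (by positivity) hxT
  have hMm : ∀ {Q x : ℝ}, ell D ^ 9 / 4 ≤ Real.log Q → 0 ≤ Real.log x → Real.log x ≤ τ →
      Real.log x / Real.log Q * (1 + Real.log x) ≤ m := by
    intro Q x hℓQ h0 hτ'
    calc Real.log x / Real.log Q * (1 + Real.log x)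
        ≤ τ / (ell D ^ 9 / 4) * (2 * τ) :=
          mul_le_mul (div_le_div₀ hτ0.le hτ' (by positivity) hℓQ) (by linarith) (by linarith)
            (div_nonneg hτ0.le (by positivity))
      _ = 8 * τ ^ 2 / ell D ^ 9 := by ring
      _ = m := hm.symm
  have hNν : ∀ {Q x s : ℝ}, ell D ^ 9 / 4 ≤ Real.log Q → 0 ≤ Real.log x → Real.log x ≤ τ →
      0 ≤ s → s ≤ C₂ * ell D * (1 + Real.log x) ^ 3 → Real.log x / Real.log Q * s ≤ ν := by
    intro Q x s hℓQ h0 hτ' hs0 hs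
    have h3 : (1 + Real.log x) ^ 3 ≤ (2 * τ) ^ 3 := pow_le_pow_left₀ (by linarith) (by linarith) 3
    calc Real.log x / Real.log Q * s
        ≤ τ / (ell D ^ 9 / 4) * (C₂ * ell D * (2 * τ) ^ 3) :=
          mul_le_mul (div_le_div₀ hτ0.le hτ' (by positivity) hℓQ)
            (hs.trans (mul_le_mul_of_nonneg_left h3 (mul_nonneg hC₂ hL0.le))) hs0
            (div_nonneg hτ0.le (by positivity))
      _ = 32 * C₂ * τ ^ 4 / ell D ^ 8 := by field_simp; ring
      _ = ν := hν.symm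
  have hM₂m : ∀ {n : ℕ} {p : ℕ × ℕ}, p ∈ Nat.divisorsAntidiagonal n →
      Skeleton.P2 D / bigT D ≤ n → (n : ℝ) < Skeleton.P2 D → ‖M₂ p‖ ≤ m := by
    intro n p hp hTn hn
    obtain ⟨hpn, -, -, hn1⟩ := hfacts hp
    obtain ⟨-, -, h0, hτ'⟩ := htail hP2pos hTn hn
    have h := norm_M2_le c' χ hL2 j (k := p.1 * p.2) (by rw [hpn]; exact hn1) (by rw [hpn]; exact hn)
    have hcast : ((p.1 * p.2 : ℕ) : ℝ) = (n : ℝ) := by rw [hpn]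
    rw [hcast] at h
    simp only [hM₂]
    exact h.trans (hMm hlogP2 h0 hτ')
  have hM₃m : ∀ {n : ℕ} {p : ℕ × ℕ}, p ∈ Nat.divisorsAntidiagonal n →
      Skeleton.P3 D / bigT D ≤ n → (n : ℝ) < Skeleton.P3 D → ‖M₃ p‖ ≤ m := by
    intro n p hp hTn hn
    obtain ⟨hpn, -, -, hn1⟩ := hfacts hp
    obtain ⟨-, -, h0, hτ'⟩ := htail hP3pos hTn hn
    have h := norm_M3_le c' χ hL4 j (k := p.1 * p.2) (by rw [hpn]; exact hn1) (by rw [hpn]; exact hn)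
    have hcast : ((p.1 * p.2 : ℕ) : ℝ) = (n : ℝ) := by rw [hpn]
    rw [hcast] at h
    simp only [hM₃]
    exact h.trans (hMm hlogP3' h0 hτ')
  have hN₂ν : ∀ {n : ℕ} {p : ℕ × ℕ}, p ∈ Nat.divisorsAntidiagonal n →
      Skeleton.P2 D / bigT D ≤ n → (n : ℝ) < Skeleton.P2 D → ‖N₂ p‖ ≤ ν := by
    intro n p hp hTn hn
    obtain ⟨hpn, hp1, hp2, hn1⟩ := hfacts hp
    obtain ⟨hx1, hxT, h0, hτ'⟩ := htail hP2pos hTn hn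
    have hkP : ((p.1 * p.2 : ℕ) : ℝ) < Skeleton.P2 D := by rw [hpn]; exact hn
    have hkP1 : ((p.1 * p.2 : ℕ) : ℝ) < Skeleton.P1 D := lt_of_lt_of_le hkP hP2P1
    have h := norm_N2_le c' χ hL2 j p.1 p.2 (k := p.1 * p.2) (by rw [hpn]; exact hn1) hkP
    have hξ' := hξ p.1 p.2 hp1 hp2 hkP1 (Skeleton.P2 D / ((p.1 * p.2 : ℕ) : ℝ))
      (by rw [hpn]; exact hx1) (by rw [hpn]; exact hxT)
    have hcast : ((p.1 * p.2 : ℕ) : ℝ) = (n : ℝ) := by rw [hpn]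
    rw [hcast] at h hξ'
    simp only [hN₂]
    exact h.trans (hNν hlogP2 h0 hτ' (Finset.sum_nonneg fun _ _ => by positivity) hξ')
  have hN₃ν : ∀ {n : ℕ} {p : ℕ × ℕ}, p ∈ Nat.divisorsAntidiagonal n →
      Skeleton.P3 D / bigT D ≤ n → (n : ℝ) < Skeleton.P3 D → ‖N₃ p‖ ≤ ν := by
    intro n p hp hTn hn
    obtain ⟨hpn, hp1, hp2, hn1⟩ := hfacts hp
    obtain ⟨hx1, hxT, h0, hτ'⟩ := htail hP3pos hTn hn
    have hkP : ((p.1 * p.2 : ℕ) : ℝ) < Skeleton.P3 D := by rw [hpn]; exact hn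
    have hkP1 : ((p.1 * p.2 : ℕ) : ℝ) < Skeleton.P1 D := lt_of_lt_of_le hkP hP3P1
    have h := norm_N3_le c' χ hL4 j p.1 p.2 (k := p.1 * p.2) (by rw [hpn]; exact hn1) hkP
    have hξ' := hξ p.1 p.2 hp1 hp2 hkP1 (Skeleton.P3 D / ((p.1 * p.2 : ℕ) : ℝ))
      (by rw [hpn]; exact hx1) (by rw [hpn]; exact hxT)
    have hcast : ((p.1 * p.2 : ℕ) : ℝ) = (n : ℝ) := by rw [hpn]
    rw [hcast] at h hξ'
    simp only [hN₃]
    exact h.trans (hNν hlogP3' h0 hτ' (Finset.sum_nonneg fun _ _ => by positivity) hξ')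
  -- Step 4: the four range totals
  have hmem : ∀ {Y Z : ℝ} {n : ℕ}, n ∈ Finset.Ico ⌈Y⌉₊ ⌈Z⌉₊ → Y ≤ n ∧ (n : ℝ) < Z :=
    fun h => ⟨Nat.ceil_le.mp (Finset.mem_Ico.mp h).1, Nat.lt_ceil.mp (Finset.mem_Ico.mp h).2⟩
  have TI : ∑ n ∈ Finset.Ico 1 ⌈Skeleton.P3 D / bigT D⌉₊, ∑ p ∈ Nat.divisorsAntidiagonal n,
      ‖w p‖ * ‖(M₂ p + κ * M₃ p) * (N₂ p + conj κ * N₃ p) -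
        (A₂ p + κ * A₃ p) * (B₂ p + conj κ * B₃ p)‖ ≤
      2 * Real.exp 430 * (18 * δ * σ) * (1 + Real.log (Skeleton.P3 D / bigT D)) := by
    have h := range_sum_le_rel c' χ j (Y := 1) (Z := Skeleton.P3 D / bigT D) (E := 18 * δ * σ) le_rfl
      hP3T1 hEI0
      (fun p => (M₂ p + κ * M₃ p) * (N₂ p + conj κ * N₃ p) -
        (A₂ p + κ * A₃ p) * (B₂ p + conj κ * B₃ p))
      (fun n hn p hp => by
        have hnlt : (n : ℝ) < Skeleton.P3 D / bigT D := (hmem hn).2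
        have h3 : (n : ℝ) < Skeleton.P3 D := lt_of_lt_of_le hnlt hP3TP3
        have h2T : (n : ℝ) < Skeleton.P2 D / bigT D := lt_of_lt_of_le h3 hP3P2T
        have h2 : (n : ℝ) < Skeleton.P2 D := lt_of_lt_of_le h2T hP2TP2
        exact pointwise_I_rel hκ (hMA₂ hp h2T) (hMA₃ hp hnlt) (hNB₂ hp h2T) (hNB₃ hp hnlt)
          (hA₂p hp h2) (hA₃p hp h3) (hB₂p hp h2) (hB₃p hp h3) (norm_nonneg _) hδσ
          (one_le_relFac n))
    rw [Nat.ceil_one, div_one] at h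
    simpa only [hw] using h
  have TII : ∑ n ∈ Finset.Ico ⌈Skeleton.P3 D / bigT D⌉₊ ⌈Skeleton.P3 D⌉₊,
      ∑ p ∈ Nat.divisorsAntidiagonal n,
      ‖w p‖ * ‖(M₂ p + κ * M₃ p) * (N₂ p + conj κ * N₃ p) -
        (A₂ p + κ * A₃ p) * (B₂ p + conj κ * B₃ p)‖ ≤
      2 * Real.exp 430 * (27 * σ ^ 2 + 12 * σ * ν + 12 * m * σ + 4 * m * ν) *
        (1 + Real.log (Skeleton.P3 D / (Skeleton.P3 D / bigT D))) := by
    have h := range_sum_le_rel c' χ j (Y := Skeleton.P3 D / bigT D) (Z := Skeleton.P3 D)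
      (E := 27 * σ ^ 2 + 12 * σ * ν + 12 * m * σ + 4 * m * ν) hP3T1 hP3TP3 hEII0
      (fun p => (M₂ p + κ * M₃ p) * (N₂ p + conj κ * N₃ p) -
        (A₂ p + κ * A₃ p) * (B₂ p + conj κ * B₃ p))
      (fun n hn p hp => by
        obtain ⟨hnT, hn3⟩ := hmem hn
        have h2T : (n : ℝ) < Skeleton.P2 D / bigT D := lt_of_lt_of_le hn3 hP3P2T
        have h2 : (n : ℝ) < Skeleton.P2 D := lt_of_lt_of_le h2T hP2TP2
        exact pointwise_II_rel hκ (hMA₂ hp h2T) (hNB₂ hp h2T) (hM₃m hp hnT hn3) (hN₃ν hp hnT hn3)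
          (hA₂p hp h2) (hA₃p hp hn3) (hB₂p hp h2) (hB₃p hp hn3) (norm_nonneg _) hδσ
          (one_le_relFac n))
    simpa only [hw] using h
  have TIII : ∑ n ∈ Finset.Ico ⌈Skeleton.P3 D⌉₊ ⌈Skeleton.P2 D / bigT D⌉₊,
      ∑ p ∈ Nat.divisorsAntidiagonal n, ‖w p‖ * ‖M₂ p * N₂ p - A₂ p * B₂ p‖ ≤
      2 * Real.exp 430 * (2 * δ * σ) * (1 + Real.log (Skeleton.P2 D / bigT D / Skeleton.P3 D)) := by
    have h := range_sum_le_rel c' χ j (Y := Skeleton.P3 D) (Z := Skeleton.P2 D / bigT D)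
      (E := 2 * δ * σ) hP3one.le hP3P2T hEIII0 (fun p => M₂ p * N₂ p - A₂ p * B₂ p)
      (fun n hn p hp => by
        obtain ⟨-, hn2⟩ := hmem hn
        have h2 : (n : ℝ) < Skeleton.P2 D := lt_of_lt_of_le hn2 hP2TP2
        exact pointwise_III_rel (hMA₂ hp hn2) (hNB₂ hp hn2) (hA₂p hp h2) (hB₂p hp h2)
          (norm_nonneg _) hδσ (one_le_relFac n))
    simpa only [hw] using h
  have TIV : ∑ n ∈ Finset.Ico ⌈Skeleton.P2 D / bigT D⌉₊ ⌈Skeleton.P2 D⌉₊,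
      ∑ p ∈ Nat.divisorsAntidiagonal n, ‖w p‖ * ‖M₂ p * N₂ p - A₂ p * B₂ p‖ ≤
      2 * Real.exp 430 * (m * ν + σ ^ 2) *
        (1 + Real.log (Skeleton.P2 D / (Skeleton.P2 D / bigT D))) := by
    have h := range_sum_le_rel c' χ j (Y := Skeleton.P2 D / bigT D) (Z := Skeleton.P2 D)
      (E := m * ν + σ ^ 2) (hP3T1.trans (div_le_div_of_nonneg_right hP3P2 hT0.le)) hP2TP2
      hEIV0 (fun p => M₂ p * N₂ p - A₂ p * B₂ p)
      (fun n hn p hp => by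
        obtain ⟨hnT, hn2⟩ := hmem hn
        exact pointwise_IV_rel (hM₂m hp hnT hn2) (hN₂ν hp hnT hn2) (hA₂p hp hn2) (hB₂p hp hn2)
          (norm_nonneg _) (one_le_relFac n))
    simpa only [hw] using h
  -- Step 5: assemble
  have normbound : ∀ (s : Finset ℕ) (F G : ℕ × ℕ → ℂ),
      ‖(∑ n ∈ s, ∑ p ∈ Nat.divisorsAntidiagonal n, w p * F p) -
          ∑ n ∈ s, ∑ p ∈ Nat.divisorsAntidiagonal n, w p * G p‖ ≤
        ∑ n ∈ s, ∑ p ∈ Nat.divisorsAntidiagonal n, ‖w p‖ * ‖F p - G p‖ := by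
    intro s F G
    rw [← Finset.sum_sub_distrib]
    refine (norm_sum_le _ _).trans (Finset.sum_le_sum fun n _ => ?_)
    rw [← Finset.sum_sub_distrib]
    refine (norm_sum_le _ _).trans (Finset.sum_le_sum fun p _ => ?_)
    rw [← mul_sub, norm_mul]
  have h12 := normbound (Finset.Ico 1 ⌈Skeleton.P3 D⌉₊)
    (fun p => (M₂ p + κ * M₃ p) * (N₂ p + conj κ * N₃ p))
    (fun p => (A₂ p + κ * A₃ p) * (B₂ p + conj κ * B₃ p))
  have h34 := normbound (Finset.Ico ⌈Skeleton.P3 D⌉₊ ⌈Skeleton.P2 D⌉₊)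
    (fun p => M₂ p * N₂ p) (fun p => A₂ p * B₂ p)
  beta_reduce at h12 h34
  have hc1 : 1 ≤ ⌈Skeleton.P3 D / bigT D⌉₊ :=
    Nat.one_le_iff_ne_zero.mpr (Nat.ceil_pos.mpr (div_pos hP3pos hT0)).ne'
  have hc2 : ⌈Skeleton.P3 D / bigT D⌉₊ ≤ ⌈Skeleton.P3 D⌉₊ := Nat.ceil_mono hP3TP3
  have hc3 : ⌈Skeleton.P3 D⌉₊ ≤ ⌈Skeleton.P2 D / bigT D⌉₊ := Nat.ceil_mono hP3P2T
  have hc4 : ⌈Skeleton.P2 D / bigT D⌉₊ ≤ ⌈Skeleton.P2 D⌉₊ := Nat.ceil_mono hP2TP2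
  -- the logarithms of the range lengths
  have hlogA : Real.log (Skeleton.P3 D / bigT D) ≤ ell D ^ 9 := by
    rw [← hlogP]; exact Real.log_le_log (by positivity) (hP3TP3.trans hP3P.le)
  have hlogB : Real.log (Skeleton.P3 D / (Skeleton.P3 D / bigT D)) = τ := by
    rw [← hlogT]; congr 1; field_simp
  have hlogC : Real.log (Skeleton.P2 D / bigT D / Skeleton.P3 D) ≤ ell D ^ 9 := by
    rw [← hlogP]
    refine Real.log_le_log (by positivity) (le_trans ?_ hP2P.le)
    rw [div_div]
    exact div_le_self hP2pos.le (one_le_mul_of_one_le_of_one_le hT1.le hP3one.le)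
  have hlogD : Real.log (Skeleton.P2 D / (Skeleton.P2 D / bigT D)) = τ := by
    rw [← hlogT]; congr 1; field_simp
  have hL9 : 1 ≤ ell D ^ 9 := one_le_pow₀ hL1
  rw [hSj, hTgt]
  have hfactor : ∀ X₁ X₂ Y₁ Y₂ : ℂ,
      conj iota4 * iota4 * X₁ + conj iota4 * iota4 * X₂ - (conj iota4 * iota4 * Y₁ + conj iota4 * iota4 * Y₂) =
        (conj iota4 * iota4) * ((X₁ - Y₁) + (X₂ - Y₂)) := by
    intros; ring
  rw [hfactor, norm_mul]
  refine (mul_le_mul hc44 ((norm_add_le _ _).trans (add_le_add h12 h34)) (norm_nonneg _)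
    (by norm_num)).trans ?_
  rw [← Finset.sum_Ico_consecutive _ hc1 hc2, ← Finset.sum_Ico_consecutive _ hc3 hc4]
  refine (mul_le_mul_of_nonneg_left (add_le_add (add_le_add TI TII) (add_le_add TIII TIV))
    (by norm_num)).trans ?_
  rw [hlogB, hlogD]
  have hJ : 18 * δ * σ * (2 * ell D ^ 9) + (27 * σ ^ 2 + 12 * σ * ν + 12 * m * σ + 4 * m * ν) *
      (2 * τ) + 2 * δ * σ * (2 * ell D ^ 9) + (m * ν + σ ^ 2) * (2 * τ) ≤
      (40 * C₁ * S + 56 * S ^ 2 + 768 * S * C₂ + 192 * S + 2560 * C₂) * u := by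
    linarith [s1, s2, s3, s4, s5]
  calc 4 * (2 * Real.exp 430 * (18 * δ * σ) * (1 + Real.log (Skeleton.P3 D / bigT D)) +
        2 * Real.exp 430 * (27 * σ ^ 2 + 12 * σ * ν + 12 * m * σ + 4 * m * ν) * (1 + τ) +
        (2 * Real.exp 430 * (2 * δ * σ) * (1 + Real.log (Skeleton.P2 D / bigT D / Skeleton.P3 D)) +
          2 * Real.exp 430 * (m * ν + σ ^ 2) * (1 + τ)))
      ≤ 4 * (2 * Real.exp 430 * (18 * δ * σ) * (2 * ell D ^ 9) +
        2 * Real.exp 430 * (27 * σ ^ 2 + 12 * σ * ν + 12 * m * σ + 4 * m * ν) * (2 * τ) +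
        (2 * Real.exp 430 * (2 * δ * σ) * (2 * ell D ^ 9) +
          2 * Real.exp 430 * (m * ν + σ ^ 2) * (2 * τ))) :=
        mul_le_mul_of_nonneg_left (add_le_add
          (add_le_add (mul_le_mul_of_nonneg_left (by linarith) (mul_nonneg he430 hEI0))
            (mul_le_mul_of_nonneg_left (by linarith) (mul_nonneg he430 hEII0)))
          (add_le_add (mul_le_mul_of_nonneg_left (by linarith) (mul_nonneg he430 hEIII0))
            (mul_le_mul_of_nonneg_left (by linarith) (mul_nonneg he430 hEIV0)))) (by norm_num)
    _ = 4 * (2 * Real.exp 430 * (18 * δ * σ * (2 * ell D ^ 9) +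
        (27 * σ ^ 2 + 12 * σ * ν + 12 * m * σ + 4 * m * ν) * (2 * τ) +
        2 * δ * σ * (2 * ell D ^ 9) + (m * ν + σ ^ 2) * (2 * τ))) := by ring
    _ ≤ 4 * (2 * Real.exp 430 *
        ((40 * C₁ * S + 56 * S ^ 2 + 768 * S * C₂ + 192 * S + 2560 * C₂) * u)) :=
        mul_le_mul_of_nonneg_left (mul_le_mul_of_nonneg_left hJ (by positivity)) (by norm_num)
    _ = 4 * (Real.exp 430 * (80 * C₁ * S + 112 * S ^ 2 + 1536 * S * C₂ + 384 * S + 5120 * C₂)) *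
        u := by ring

end Literature.NumberTheory.LFunctions.Zhang2022.Section9Gathering
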